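import Mathlib
import Literature.Computability.Complexity.RangeAvoidance
import Literature.Computability.Complexity.SignDegreeXor
import Summits.PneNP.PneNP.Theorems.PstarTyped
import Summits.PneNP.PneNP.Theorems.PstarSALevel
import Summits.PneNP.PneNP.Theorems.PstarSASDPLevel

/-!
# Sub-instances of a local map: deleting outputs keeps purity, typedness and boundary expansion (alteration tool)

FRONTIER range-avoidance ladder (cell `pnp-ideate`; restricted-model combinatorics — nothing here bears on `P` versus `NP`).

The ALTERATION step of the probabilistic method for local maps: keep only the outputs of a set `S` (`restrictTo I S :
LocalMap k n S.card`, outputs re-indexed increasingly by `Finset.orderEmbOfFin`).  Everything the Sherali–Adams hubs consume is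
inherited — `IsPure`, `PstarTyped.Typed`, and `PstarSASDPLevel.BoundaryExpandingQ a b r` (the boundary of a set of outputs depends
on those outputs only: `bdry_restrict`) — while `PstarSALevel.SimpleOverlap` holds as soon as `S` avoids one output of every pair
sharing two variables (`simpleOverlap_restrictTo`).  Used to upgrade first-moment existence theorems (which control boundary
badness only) to families with simple overlaps, the hypothesis of the SA+SDP hubs `PstarSASDPLevel.TypedSASDPLinearLevel` /
`PairwiseSA.pairwiseSASDPLinearLevel`.
-/

set_option linter.dupNamespace false -- `Summit.PneNP.PneNP.…`: summit = sub-problem name (D-0017 single-conjunct layout)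

open Finset Literature.Computability.Complexity
open Summit.PneNP.PneNP.Theorems.PstarTyped (Typed)
open Summit.PneNP.PneNP.Theorems.PstarSALevel (varSet bdry SimpleOverlap)
open Summit.PneNP.PneNP.Theorems.PstarSASDPLevel (BoundaryExpandingQ)

namespace Summit.PneNP.PneNP.Theorems.PstarSubInstance

variable {k n m m' : ℕ}

/-! ## Restriction along an injection of outputs -/

/-- The sub-instance keeping the outputs `e 0, …, e (m'−1)`. -/
def restrict (I : LocalMap k n m) (e : Fin m' ↪ Fin m) : LocalMap k n m' where
  vars j := I.vars (e j)
  table j := I.table (e j)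

/-- Restriction keeps purity. -/
theorem isPure_restrict {P : (Fin k → Bool) → Bool} {I : LocalMap k n m} (hI : I.IsPure P) (e : Fin m' ↪ Fin m) :
    (restrict I e).IsPure P :=
  ⟨fun j => hI.1 (e j), fun j => hI.2 (e j)⟩

/-- Restriction keeps typedness. -/
theorem typed_restrict {I : LocalMap 4 n m} (hT : Typed I) (e : Fin m' ↪ Fin m) : Typed (restrict I e) :=
  fun j j' s s' hs hs' => hT (e j) (e j') s s' hs hs'

/-- Variable sets of the sub-instance. -/
theorem varSet_restrict (I : LocalMap k n m) (e : Fin m' ↪ Fin m) (j : Fin m') :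
    varSet (restrict I e) j = varSet I (e j) := rfl

/-- The boundary of `J` in the sub-instance is the boundary of its image in `I`. -/
theorem bdry_restrict (I : LocalMap k n m) (e : Fin m' ↪ Fin m) (J : Finset (Fin m')) :
    bdry (restrict I e) J = bdry I (J.map e) := by
  ext v
  simp only [PstarSALevel.bdry, mem_filter, mem_univ, true_and]
  rw [filter_map, card_map]
  rfl

/-- **Boundary expansion is inherited by sub-instances.** -/
theorem boundaryExpandingQ_restrict {a b r : ℕ} {I : LocalMap k n m} (h : BoundaryExpandingQ a b r I) (e : Fin m' ↪ Fin m) :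
    BoundaryExpandingQ a b r (restrict I e) := by
  intro J hJ
  have := h (J.map e) (by rw [card_map]; exact hJ)
  rw [card_map] at this
  rw [bdry_restrict]
  exact this

/-- Evaluation of the sub-instance: the kept coordinates of `I.eval`. -/
theorem eval_restrict (I : LocalMap k n m) (e : Fin m' ↪ Fin m) (x : Fin n → Bool) (j : Fin m') :
    (restrict I e).eval x j = I.eval x (e j) := rfl

/-! ## Restriction to a set of outputs -/

/-- The sub-instance on the outputs of `S` (increasing re-indexing). -/
def restrictTo (I : LocalMap k n m) (S : Finset (Fin m)) : LocalMap k n S.card :=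
  restrict I (S.orderEmbOfFin rfl).toEmbedding

/-- The kept outputs are members of `S`. -/
theorem orderEmb_mem (S : Finset (Fin m)) (j : Fin S.card) : (S.orderEmbOfFin rfl).toEmbedding j ∈ S :=
  Finset.orderEmbOfFin_mem S rfl j

/-- Purity of `restrictTo`. -/
theorem isPure_restrictTo {P : (Fin k → Bool) → Bool} {I : LocalMap k n m} (hI : I.IsPure P) (S : Finset (Fin m)) :
    (restrictTo I S).IsPure P :=
  isPure_restrict hI _

/-- Typedness of `restrictTo`. -/
theorem typed_restrictTo {I : LocalMap 4 n m} (hT : Typed I) (S : Finset (Fin m)) : Typed (restrictTo I S) :=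
  typed_restrict hT _

/-- Boundary expansion of `restrictTo`. -/
theorem boundaryExpandingQ_restrictTo {a b r : ℕ} {I : LocalMap k n m} (h : BoundaryExpandingQ a b r I)
    (S : Finset (Fin m)) : BoundaryExpandingQ a b r (restrictTo I S) :=
  boundaryExpandingQ_restrict h _

/-- **Simple overlaps after alteration**: if no two distinct outputs of `S` share two variables, `restrictTo I S` has
simple overlaps. -/
theorem simpleOverlap_restrictTo {I : LocalMap k n m} {S : Finset (Fin m)}
    (hS : ∀ j ∈ S, ∀ j' ∈ S, j ≠ j' → (varSet I j ∩ varSet I j').card ≤ 1) : SimpleOverlap (restrictTo I S) := by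
  intro j j' hjj'
  unfold restrictTo
  rw [varSet_restrict, varSet_restrict]
  exact hS _ (orderEmb_mem S j) _ (orderEmb_mem S j')
    (fun h => hjj' ((S.orderEmbOfFin rfl).toEmbedding.injective h))

/-- A set that avoids one member of every two-variable-sharing pair supports an alteration: with `D ⊇` one output from
each such pair, `S = univ \ D` qualifies. -/
theorem pairwise_of_sdiff {I : LocalMap k n m} {D : Finset (Fin m)}
    (hD : ∀ j j' : Fin m, j < j' → 2 ≤ (varSet I j ∩ varSet I j').card → j' ∈ D) :
    ∀ j ∈ univ \ D, ∀ j' ∈ univ \ D, j ≠ j' → (varSet I j ∩ varSet I j').card ≤ 1 := by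
  intro j hj j' hj' hne
  rw [mem_sdiff] at hj hj'
  by_contra hlt
  push Not at hlt
  rcases lt_or_gt_of_ne hne with h | h
  · exact hj'.2 (hD j j' h hlt)
  · rw [inter_comm] at hlt
    exact hj.2 (hD j' j h hlt)

/-- Size of the altered instance: `#(univ ∖ D) = m − #D`. -/
theorem card_univ_sdiff (D : Finset (Fin m)) : (univ \ D).card = m - D.card := by
  rw [card_sdiff_of_subset (subset_univ D), card_univ, Fintype.card_fin]

end Summit.PneNP.PneNP.Theorems.PstarSubInstance
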